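import Summits.QuantumFields.YangMills.Theorems.ChatterjeeMassGapTorusAxialOneBitAllGroups
import Literature.MathematicalPhysics.QuantumLattice.HeatKernelGroupCircleKernelProofs
import Literature.Barriers.QuantumFields.AbelianDeconfinementD4
import HarnessLib

/-!
# The one bit of `S28ᵀ` in the abelian control case: `κ_□(U(1)) = 2⁻⁹` and
`p_Λ^{(8)}(0) = 8!/512`, as kernel theorems (item 8941 lane, calibration row)

Seat ym-dw-p1 g7. The instrument row of ym-idea-4 g6 (evidence #23 on item 8941: exact Bessel
character expansion of compact `U(1)₄`, charge one, free boundary) found, by rational arithmetic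
OUTSIDE Lean, `p_Λ(β) = β⁸/512 − (17/4096)β¹⁰ + …` on five regions containing the box sites, i.e.
`[β⁸] p_Λ = 2⁻⁹`. This file makes the same number a theorem of the formal chain — an end-to-end
consistency check of (O1) `S28OneBitCompact.boxLocality` (every compact `G`) and of the
box-gluing evaluation `S28BoxBitSUN.boxIntegral_eq_of_kernel` against an independent exact
computation:

* `u1_kernel` — the MERGE kernel of `U(1)`: `∫ Re(x ḡ) Re(g y) dg = ½ Re(x y)` (orthogonality
  of the characters `z^{±2}`), so `Re` is a self-reproducing kernel with constant `c = ½`;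
* `boxIntegral_u1`, `boxCumulant_u1` — the (un)centred box integral of the fork for
  `ρ = u1Rep` is `c⁹ · 1 = 2⁻⁹ = 1/512` (`m₀ = ∫ Re = 0`);
* `iteratedDeriv_eight_u1` — **for every finite `Λ ⊇` the twelve box sites,
  `p_Λ^{(8)}(0) = 8! / 512 = 315/4`** — the registered abelian value;
* `torusCoefficient_eight_u1` — the same number on the periodic lattice `(ℤ/(L+1)ℤ)⁴` for all
  large `L` (what a periodic series code measures);
* `gapCore_eventually_u1` — the strong-coupling island gap core for `U(1)₄` (positive axial
  plaquette correlations and a positive inverse axial correlation length in every torus-limit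
  state for all small `β > 0`; consistent with, and far from, the Guth/Fröhlich–Spencer
  deconfining transition at LARGE `β`).

Scope: a calibration of the formal chain on the abelian control case; `U(1)` is not a gauge group
of the statement `S28ᵀ` (not simple); no summit conjunct is touched; the Yang–Mills mass gap is
NOT proved. References: K. Osterwalder, E. Seiler, Ann. Phys. 110 (1978) 440; A. Guth, Phys. Rev.
D 21 (1980) 2291.
-/

noncomputable section

open MeasureTheory Filter Topology
open Literature.MathematicalPhysics.QuantumLattice
open Literature.MathematicalPhysics.QuantumFieldTheory
open Literature.Probability.LatticeModels (Site HasInvCorrLength)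

namespace Summit.QuantumFields.YangMills.Theorems.S28OneBitU1

/-- `Re tr u1Rep(z) = Re z`. [folklore] -/
theorem u1Rep_trace_re (z : Circle) : ((u1Rep z).trace).re = (z : ℂ).re := by
  simp [u1Rep_apply, Matrix.scalar_apply, Matrix.trace]

/-- `Re u · Re v = ½ (Re(uv) + Re(u v̄))`. [folklore] -/
theorem re_mul_re (u v : ℂ) :
    u.re * v.re = 2⁻¹ * ((u * v).re + (u * (starRingEnd ℂ) v).re) := by
  simp only [Complex.mul_re, Complex.conj_re, Complex.conj_im]
  ring

/-- The integrand of the `U(1)` MERGE kernel: `Re(x ḡ) Re(g y) = ½ Re(xy) + ½ Re(x ȳ ḡ²)`.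
[folklore] -/
theorem u1_integrand (x y g : Circle) :
    ((x * g⁻¹ : Circle) : ℂ).re * ((g * y : Circle) : ℂ).re =
      2⁻¹ * ((x * y : Circle) : ℂ).re + 2⁻¹ * ((x * y⁻¹ * (g⁻¹ * g⁻¹) : Circle) : ℂ).re := by
  rw [re_mul_re, ← Circle.coe_inv_eq_conj, ← Circle.coe_mul, ← Circle.coe_mul, mul_add]
  congr 3
  · push_cast
    have hg : ((g : ℂ)) ≠ 0 := Circle.coe_ne_zero g
    field_simp
  · push_cast
    have hg : ((g : ℂ)) ≠ 0 := Circle.coe_ne_zero g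
    have hy : ((y : ℂ)) ≠ 0 := Circle.coe_ne_zero y
    field_simp

/-- `∫_{U(1)} Re(c ḡ²) dg = 0` (the character `z⁻²` has Haar mean zero). [folklore] -/
theorem integral_re_mul_inv_sq (c : Circle) :
    ∫ g, ((c * (g⁻¹ * g⁻¹) : Circle) : ℂ).re ∂haarProbability Circle = 0 := by
  have hfun : (fun g : Circle => ((c * (g⁻¹ * g⁻¹) : Circle) : ℂ).re) =
      fun g : Circle => (((c : ℂ)) * (g : ℂ) ^ (-2 : ℤ)).re := by
    funext g
    congr 1
    push_cast
    have hg : ((g : ℂ)) ≠ 0 := Circle.coe_ne_zero g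
    rw [zpow_neg, zpow_two, mul_inv]
  rw [hfun]
  have hzc : Continuous fun g : Circle => ((c : ℂ)) * (g : ℂ) ^ (-2 : ℤ) :=
    continuous_const.mul ((continuous_subtype_val : Continuous fun z : Circle => (z : ℂ)).zpow₀ _
      fun z => Or.inl (Circle.coe_ne_zero z))
  have hint : Integrable (fun g : Circle => ((c : ℂ)) * (g : ℂ) ^ (-2 : ℤ)) (haarProbability Circle) :=
    Integrable.of_bound hzc.aestronglyMeasurable (1 : ℝ)
      (Eventually.of_forall fun z => by
        rw [norm_mul, norm_zpow, Circle.norm_coe, Circle.norm_coe, one_zpow, one_mul])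
  have h := integral_re hint
  simp only [RCLike.re_to_complex] at h
  rw [h, integral_const_mul, integral_coe_zpow_haarProbability_circle]
  simp

/-- **The MERGE kernel of `U(1)`**: `∫ Re(x ḡ) Re(g y) dg = ½ Re(x y)` — `Re` is a
self-reproducing convolution kernel on `U(1)` with constant `c = ½`. [folklore] -/
theorem u1_kernel (x y : Circle) :
    ∫ g, ((x * g⁻¹ : Circle) : ℂ).re * ((g * y : Circle) : ℂ).re ∂haarProbability Circle =
      2⁻¹ * ((x * y : Circle) : ℂ).re := by
  simp_rw [u1_integrand]
  have hc2 : Continuous fun g : Circle => ((x * y⁻¹ * (g⁻¹ * g⁻¹) : Circle) : ℂ).re :=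
    Complex.continuous_re.comp (continuous_subtype_val.comp (continuous_const.mul
      ((continuous_inv).mul continuous_inv)))
  have hint2 : Integrable (fun g : Circle => 2⁻¹ * ((x * y⁻¹ * (g⁻¹ * g⁻¹) : Circle) : ℂ).re)
      (haarProbability Circle) :=
    (Integrable.of_bound hc2.aestronglyMeasurable (1 : ℝ)
      (Eventually.of_forall fun z => by
        rw [Real.norm_eq_abs]
        exact (Complex.abs_re_le_norm _).trans (by rw [Circle.norm_coe]))).const_mul _
  rw [integral_add (integrable_const _) hint2, integral_const, probReal_univ, one_smul,
    integral_const_mul, integral_re_mul_inv_sq, mul_zero, add_zero]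

/-- The MERGE kernel in the `Re tr ρ` form used by `S28BoxBitSUN.boxIntegral_eq_of_kernel`.
[folklore] -/
theorem u1Rep_kernel (x y : Circle) :
    ∫ g, ((u1Rep (x * g⁻¹)).trace).re * ((u1Rep (g * y)).trace).re ∂haarProbability Circle =
      (1 / 2 : ℝ) * ((u1Rep (x * y)).trace).re := by
  simp_rw [u1Rep_trace_re]
  rw [u1_kernel, one_div]

/-- `Re tr u1Rep` is inversion invariant. [folklore] -/
theorem u1Rep_trace_re_inv (h : Circle) : ((u1Rep h⁻¹).trace).re = ((u1Rep h).trace).re := by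
  rw [u1Rep_trace_re, u1Rep_trace_re, Circle.coe_inv_eq_conj, Complex.conj_re]

/-- The centring constant vanishes: `m₀ = ∫ Re tr u1Rep = ∫ Re z dz = 0`. [folklore] -/
theorem integral_u1Rep_trace_re : ∫ g, ((u1Rep g).trace).re ∂haarProbability Circle = 0 := by
  simp_rw [u1Rep_trace_re]
  have hzc : Continuous fun g : Circle => ((g : ℂ)) := continuous_subtype_val
  have hint : Integrable (fun g : Circle => ((g : ℂ))) (haarProbability Circle) :=
    Integrable.of_bound hzc.aestronglyMeasurable (1 : ℝ)
      (Eventually.of_forall fun z => by rw [Circle.norm_coe])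
  have h := integral_re hint
  simp only [RCLike.re_to_complex] at h
  rw [h]
  have h1 := integral_coe_zpow_haarProbability_circle (1 : ℤ)
  simp only [zpow_one, one_ne_zero, if_false] at h1
  rw [h1, Complex.zero_re]

/-- **The uncentred box integral of the fork for `U(1)` is `2⁻⁹`.** [folklore] -/
theorem boxIntegral_u1 :
    ∫ U,
        plaquetteObs u1Rep (0 : Site 4) 1 2 U *
        plaquetteObs u1Rep (Pi.single 0 2 : Site 4) 1 2 U *
        plaquetteObs u1Rep (0 : Site 4) 0 1 U *
        plaquetteObs u1Rep (Pi.single 2 1 : Site 4) 0 1 U *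
        plaquetteObs u1Rep (0 : Site 4) 0 2 U *
        plaquetteObs u1Rep (Pi.single 1 1 : Site 4) 0 2 U *
        plaquetteObs u1Rep (Pi.single 0 1 : Site 4) 0 1 U *
        plaquetteObs u1Rep (Pi.single 0 1 + Pi.single 2 1 : Site 4) 0 1 U *
        plaquetteObs u1Rep (Pi.single 0 1 : Site 4) 0 2 U *
        plaquetteObs u1Rep (Pi.single 0 1 + Pi.single 1 1 : Site 4) 0 2 U ∂zdHaar 4 Circle =
      1 / 512 := by
  rw [S28BoxBitSUN.boxIntegral_eq_of_kernel u1Rep continuous_u1Rep u1Rep_trace_re_inv u1Rep_kernel]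
  norm_num

/-- **`κ_□(U(1)) = 2⁻⁹ = 1/512`**: the box cumulant of the fork `S28BoxBit` in its literal
centred form, for the defining representation of `U(1)`. [folklore] -/
theorem boxCumulant_u1 :
    (∫ U,
          (plaquetteObs u1Rep (0 : Site 4) 1 2 U - ∫ g, (u1Rep g).trace.re ∂(haarProbability Circle)) *
          (plaquetteObs u1Rep (Pi.single 0 2 : Site 4) 1 2 U
              - ∫ g, (u1Rep g).trace.re ∂(haarProbability Circle)) *
          (plaquetteObs u1Rep (0 : Site 4) 0 1 U - ∫ g, (u1Rep g).trace.re ∂(haarProbability Circle)) *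
          (plaquetteObs u1Rep (Pi.single 2 1 : Site 4) 0 1 U
              - ∫ g, (u1Rep g).trace.re ∂(haarProbability Circle)) *
          (plaquetteObs u1Rep (0 : Site 4) 0 2 U - ∫ g, (u1Rep g).trace.re ∂(haarProbability Circle)) *
          (plaquetteObs u1Rep (Pi.single 1 1 : Site 4) 0 2 U
              - ∫ g, (u1Rep g).trace.re ∂(haarProbability Circle)) *
          (plaquetteObs u1Rep (Pi.single 0 1 : Site 4) 0 1 U
              - ∫ g, (u1Rep g).trace.re ∂(haarProbability Circle)) *
          (plaquetteObs u1Rep (Pi.single 0 1 + Pi.single 2 1 : Site 4) 0 1 U -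
              ∫ g, (u1Rep g).trace.re ∂(haarProbability Circle)) *
          (plaquetteObs u1Rep (Pi.single 0 1 : Site 4) 0 2 U
              - ∫ g, (u1Rep g).trace.re ∂(haarProbability Circle)) *
          (plaquetteObs u1Rep (Pi.single 0 1 + Pi.single 1 1 : Site 4) 0 2 U -
              ∫ g, (u1Rep g).trace.re ∂(haarProbability Circle)) ∂(zdHaar 4 Circle)) = 1 / 512 := by
  rw [integral_u1Rep_trace_re]
  simp only [sub_zero]
  exact boxIntegral_u1

/-- **CALIBRATION THEOREM: `p_Λ^{(8)}(0) = 8!/512 = 315/4` for `U(1)₄`, charge one, every finite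
region containing the twelve box sites** — the value found by the exact Bessel expansion of the
instrument row (evidence #23 on item 8941, `[β⁸] p_Λ = 1/512`), now a consequence of
`S28OneBitCompact.boxLocality` and `boxCumulant_u1` inside the kernel. [folklore] -/
theorem iteratedDeriv_eight_u1 (Λ : Finset (Site 4))
    (hΛ : (Finset.univ : Finset (Fin 3 × Fin 2 × Fin 2)).image
        (fun v => (![((v.1 : ℕ) : ℤ), ((v.2.1 : ℕ) : ℤ), ((v.2.2 : ℕ) : ℤ), 0] : Site 4)) ⊆ Λ) :
    iteratedDeriv 8 (fun t : ℝ =>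
        (expect u1Rep (fun U => ((plaquetteObs u1Rep (0 : Site 4) 1 2 U *
              plaquetteObs u1Rep (Pi.single 0 1 : Site 4) 0 1 U : ℝ) : ℂ)) Λ t).re -
          (expect u1Rep (fun U => (plaquetteObs u1Rep (0 : Site 4) 1 2 U : ℂ)) Λ t).re *
            (expect u1Rep (fun U => (plaquetteObs u1Rep (Pi.single 0 1 : Site 4) 0 1 U : ℂ)) Λ t).re)
        0 = 315 / 4 := by
  rw [S28OneBitCompact.boxLocality u1Rep continuous_u1Rep Λ hΛ, boxCumulant_u1]
  norm_num

/-- **The same number on the periodic lattice**: for all large `L`, the eighth `t`-derivative at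
`0` of the torus truncated correlation of `Q = (0;1,2)`, `P = (e₀;0,1)` on `(ℤ/(L+1)ℤ)⁴` for
`U(1)`, charge one, is `315/4 = 8!·2⁻⁹`. [folklore] -/
theorem torusCoefficient_eight_u1 :
    ∀ᶠ L : ℕ in atTop,
      iteratedDeriv 8 (fun t : ℝ =>
          wilsonExpectation (L := L + 1) u1Rep t (toTorusObservable (L + 1)
              (fun U => plaquetteObs u1Rep (0 : Site 4) 1 2 U *
                plaquetteObs u1Rep (Pi.single 0 1 : Site 4) 0 1 U)) -
            wilsonExpectation (L := L + 1) u1Rep t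
                (toTorusObservable (L + 1) (plaquetteObs u1Rep (0 : Site 4) 1 2)) *
              wilsonExpectation (L := L + 1) u1Rep t
                (toTorusObservable (L + 1) (plaquetteObs u1Rep (Pi.single 0 1 : Site 4) 0 1)))
          0 = 315 / 4 := by
  filter_upwards [S28OneBitAllGroups.torusCoefficient_eight_eventually u1Rep continuous_u1Rep]
    with L hL
  rw [hL, boxCumulant_u1]
  norm_num

/-- **The strong-coupling island gap core for `U(1)₄`** (abelian control case; `U(1)` confines at
small `β` and deconfines only at large `β`): for all sufficiently small `β > 0`, every torus-limit
state of 4-d compact `U(1)` lattice gauge theory (charge one, Wilson action) has strictly positive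
axial plaquette correlations at all distances and a positive inverse axial correlation length.
Nothing is asserted at large `β`. [folklore] -/
theorem gapCore_eventually_u1 :
    ∀ᶠ β in 𝓝[>] (0 : ℝ), ∀ μ ∈ infiniteVolumeLimitPoints (d := 4) u1Rep β,
      (∀ n : ℕ, 0 < plaquetteCorrFn u1Rep μ ((n : ℤ) • Pi.single (0 : Fin 4) (1 : ℤ))) ∧
        ∃ m : ℝ, 0 < m ∧ HasInvCorrLength (plaquetteCorrFn u1Rep μ) m := by
  refine S28OneBitAllGroups.gapCore_eventually u1Rep continuous_u1Rep u1Rep_trace_re_inv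
    (S28BoxBitCompact.exists_re_trace_ne u1Rep u1Rep_mem_unitaryGroup u1Rep_injective
      ⟨-1, fun h => Literature.Barriers.QuantumFields.u1Rep_neg_one_ne_one (by simp [h])⟩)

end Summit.QuantumFields.YangMills.Theorems.S28OneBitU1

end
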